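import Summits.BirchSwinnertonDyer.BirchSwinnertonDyer.Theorems.UniversalToricDescentTwinTowerOneSidedInputs
import Summits.BirchSwinnertonDyer.BirchSwinnertonDyer.Theorems.UniversalToricDescentTwinTowerCorankSum
import Summits.BirchSwinnertonDyer.BirchSwinnertonDyer.Theorems.UniversalToricDescentDefectTransportResidue
import Summits.BirchSwinnertonDyer.BirchSwinnertonDyer.Theorems.EisensteinPrimesXAcImprimitiveLambdaShift
import Summits.BirchSwinnertonDyer.BirchSwinnertonDyer.Theorems.EisensteinPrimesResidualDevissageCountNonsplit
import Summits.BirchSwinnertonDyer.BirchSwinnertonDyer.Theorems.UniversalToricDescentDefectTransportTwinBaseFiniteOnly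
import HarnessLib

/-!
# Route UniversalToricDescent — the ONE-SIDED algebraic defect transport for the rank-free twin from TWO tower-level
# statements: (S′) strict-place surjectivity and (Σ′) `Σ`-local surjectivity — `λ′ + Σ′ ≤ λ + Σ`, NO (N′)
# (lands the temporary stub G≤ `stub_oneSidedGlue` of skeleton v4a on ♭T≤ stmt-BirchSwinnertonDyer-23042, line `sigmacongruence`)

Lead prover bsd-wall-utd-p1 g16. g14's two-sided glue `defectTransport_algebraicHalf_lambda_of_wall_of_twinTowerOnBadSet` needs
(N′) «`X_{𝔭′}^Σ(E′)` has no non-zero finite `Λ`-submodule» (H²-level, = the reverse λ-inequality) twice: through the divisibility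
of `Sel_{𝔭′}^Σ(E′)` in (M1) and in the `Σ`-product. The pen's one-sided restate R1-♭T≤ (UTD rev 71, item 23042: last conjunct
`n' + m ≤ n + m'`) lets both uses go:

* (M1) WITH INDEX (`…TwinTowerOneSidedInputs` §1): `#Sel^Σ(E′)[3] ≤ #Sel^Σ(E)[3] · #(Sel^Σ(E′)/3)` from (S′) alone; and
  `#(Sel^Σ(E′)/3) = #X′^Σ[3]` (ibid. §2), `3^{λ(X′^Σ)} · #X′^Σ[3] = #Sel^Σ(E′)[3]` (Eisenstein cell,
  `pow_lambdaInvariant_mul_natCard_pTorsion_eq`), `#Sel^Σ(E)[3] = 3^{λ+Σ}` (E-side, landed) ⇒ `λ(X′^Σ) ≤ λ + Σ`;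
* `λ(X′^Σ) = λ′ + corank(Sel^Σ(E′)/Sel^∅(E′))` (Eisenstein cell, `lambdaInvariant_eq_add_zpCorank_of_muInvariant_eq_zero`, on the
  Literature twins of X11b's `selmerAc`/`XAc` — definitionally equal) and `corank = Σ′ = Σ_{v∈Σ_bad} 3^{c_v} s′_v` from (Σ′) by
  corank additivity (`…TwinTowerCorankSum`).

* `Summit.….Cruxes.DefectTransportModThreePT.SigmaCongruence.stub_oneSidedGlue` — the REGISTERED stub G≤ VERBATIM (namespace and
  signature of the skeleton `Cruxes/DefectTransportModThreePT/Lines/sigmacongruence.lean`, commit 0dc41c62b5e7): B′'s binders +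
  (S′) at `Σ_bad` + (Σ′) on the subsets of `Σ_bad` ⟹ B′'s data with `λ′ + Σ′ ≤ λ + Σ`.

HONEST STATUS: CONDITIONAL on the cited Poitou–Tate facts (hypotheses) and on the twin's two tower statements (hypotheses = stubs
TS1′/TS2′, OPEN). THEOREMS ONLY; no definition, no named fact, no `sorry`. BSD is not advanced by this file.
References: [GreenbergVatsal2000] Thm. (1.4), §2 Prop. (2.1), Cor. (2.3), (2.4), (2.8), (2.10) (pp. 23–28); [GreenbergLNM1716] §4
Prop. 4.13 (pp. 122–124); [Serre1967GroupesPDivisibles] §5 Prop. 8; [Brink2007] Cor. 1.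
-/

set_option autoImplicit false
-- `…BirchSwinnertonDyer.BirchSwinnertonDyer.Theorems…` is the problem's mandated namespace (D-0017).
set_option linter.dupNamespace false

noncomputable section
open scoped Classical

namespace Summit.BirchSwinnertonDyer.BirchSwinnertonDyer.Cruxes.DefectTransportModThreePT.SigmaCongruence

open Function Field NumberField IsDedekindDomain WeierstrassCurve
open Literature.NumberTheory.GaloisRepresentations Literature.NumberTheory.EllipticCurves
  Literature.NumberTheory.EllipticCurves.GreenbergSelmer Literature.NumberTheory.GaloisCohomology
  Literature.NumberTheory.EllipticCurves.IwasawaAlgebra Literature.NumberTheory.EllipticCurves.Rank1Residual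
  Summit.BirchSwinnertonDyer.Rank1Residual Summit.BirchSwinnertonDyer.Rank1Residual.X11b
  Summit.BirchSwinnertonDyer.Rank1Residual.X11b.Coinv Summit.BirchSwinnertonDyer.Rank1Residual.X11b.AcSelmer
  Summit.BirchSwinnertonDyer.Rank1Residual.X11b.LocBridge Summit.BirchSwinnertonDyer.Rank1Residual.Iwasawa
  Summit.BirchSwinnertonDyer.BirchSwinnertonDyer.Theorems.UniversalToricDescentSigmaPassage
  Summit.BirchSwinnertonDyer.BirchSwinnertonDyer.Theorems.UniversalToricDescentSigmaLocalImage
  Summit.BirchSwinnertonDyer.BirchSwinnertonDyer.Theorems.UniversalToricDescentSigmaLocalStabilizer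
  Summit.BirchSwinnertonDyer.BirchSwinnertonDyer.Theorems.UniversalToricDescentSigmaCoinvariants
  Summit.BirchSwinnertonDyer.BirchSwinnertonDyer.Theorems.UniversalToricDescentAcDualMuZero
  Summit.BirchSwinnertonDyer.BirchSwinnertonDyer.Theorems.UniversalToricDescentTorsionMuTransportHeegner
  Summit.BirchSwinnertonDyer.BirchSwinnertonDyer.Theorems.UniversalToricDescentStrictPlaceTuple
  Summit.BirchSwinnertonDyer.BirchSwinnertonDyer.Theorems.UniversalToricDescentResidualSelmer
  Summit.BirchSwinnertonDyer.BirchSwinnertonDyer.Theorems.SchneiderFreeAdditiveX3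
  Summit.BirchSwinnertonDyer.BirchSwinnertonDyer.Theorems.SchneiderFreeControlAtoms
  Summit.BirchSwinnertonDyer.BirchSwinnertonDyer.Theorems.PotentiallySupersingularLocalTorsion

open Summit.BirchSwinnertonDyer.BirchSwinnertonDyer.Theorems.UniversalToricDescentDefectTransport
  Summit.BirchSwinnertonDyer.BirchSwinnertonDyer.Theorems.UniversalToricDescentNormProfile
  Summit.BirchSwinnertonDyer.BirchSwinnertonDyer.Theorems.UniversalToricDescentSigmaFree
  Summit.BirchSwinnertonDyer.BirchSwinnertonDyer.Theorems.UniversalToricDescentNoFiniteSubmodule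
  Summit.BirchSwinnertonDyer.BirchSwinnertonDyer.Theorems.UniversalToricDescentLambdaNormProfile
  Summit.BirchSwinnertonDyer.BirchSwinnertonDyer.Theorems

/-- **G≤ — the ONE-SIDED glue (registered stub `stub_oneSidedGlue` of skeleton v4a on ♭T≤ 23042, VERBATIM).** B′'s binders +
(S′) `hsig'` (GV Prop. 2.1 at `𝔭′` for the twin, at `Σ = Σ_bad`, every fake strict place) + (Σ′) `hsigS'` (GV Cor. 2.3 at
`v ∈ Σ_bad ∖ Σ`, `Σ ⊆ Σ_bad`) give the bad set `T = Σ_bad` with exact indices and local counts, unit-profile generators of both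
characteristic ideals, torsion of `X_{𝔭′}(E′)`, and **`λ′ + Σ′ ≤ λ + Σ`**. Proof: `Σ_bad`, `3` split, `μ(X_E) = 0` from the wall,
`Sel^{Σ_bad}(E)[3]` finite, local tower torsion finiteness at `𝔭′` (E: Serre Prop. 8 on O6; twin: reduction type), (M1) with index,
Pontryagin `#(Sel′/3) = #X′^Σ[3]`, Herbrand `3^{λ(X′^Σ)}·#X′^Σ[3] = #Sel^Σ(E′)[3]`, E-side `#Sel^Σ(E)[3] = 3^λ·∏(3^{s_v})^{3^{c_v}}`,
λ-shift `λ(X′^Σ) = λ′ + corank(Sel^Σ(E′)/Sel^∅(E′))`, corank `= Σ 3^{c_v}s′_v` from (Σ′).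
[cite: GreenbergVatsal2000, Thm. (1.4), §2 Prop. (2.1), Cor. (2.3), (2.4), (2.8), (2.10)] [cite: GreenbergLNM1716, §4 Prop. 4.13 (pp. 122–124)]
[cite: Serre1967GroupesPDivisibles, §5 Prop. 8] [cite: Brink2007, Cor. 1] -/
theorem stub_oneSidedGlue (W W' : WeierstrassCurve ℚ)
    [W.IsElliptic] [W.IsGloballyMinimal] [W'.IsElliptic] [W'.IsGloballyMinimal] {N N' : ℕ} (K : Type) [Field K]
    [NumberField K]
    (hO6 : Additive.ClassO6 W 3) (hsurj : W.HasSurjectiveModNGaloisRep 3) (hN : W.conductorNorm ℤ = N)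
    (hcong : O6.ModPCongruent W' W 3) (hadd' : ¬ Addv W' 3) (hN' : W'.conductorNorm ℤ = N')
    (hK : IsImaginaryQuadratic K)
    (hHe : SatisfiesHeegnerHypothesis N K) (hHe' : SatisfiesHeegnerHypothesis N' K)
    (κ : ZpExtension K 3) (hκ : κ.IsAnticyclotomic) (γ : absoluteGaloisGroup K)
    [Fact (κ.IsTopGenerator γ)] {𝔭' : HeightOneSpectrum (𝓞 K)} (h𝔭' : ((3 : ℕ) : 𝓞 K) ∈ 𝔭'.asIdeal)
    (hT : Module.IsTorsion (IwasawaAlgebra 3) (XAc (W.baseChange K) 3 κ 𝔭' ∅ γ))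
    {L : UnrSeries 3}
    (hle : Ideal.span {L} ≤
      (XAc.charIdeal (W.baseChange K) 3 κ 𝔭' ∅ γ).map (PowerSeries.map (Halves.toUnr 3)))
    (hi : ∃ i : ℕ, ‖((PowerSeries.coeff i L : unrIntegers 3) : ℂ_[3])‖ = 1)
    (hPT : poitouTate_selmerStructure_duality K) (hPT2 : poitouTate_sha_tateDual K)
    (hfin : ∀ v : HeightOneSpectrum (𝓞 K), ((3 : ℕ) : 𝓞 K) ∈ v.asIdeal →
      Finite (selmerAcBase (W.baseChange K) 3 v ∅))
    (hsig' : ∀ (S : Set (HeightOneSpectrum (𝓞 K))), S = {v : HeightOneSpectrum (𝓞 K) | ((3 : ℕ) : 𝓞 K) ∉ v.asIdeal ∧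
        (¬ (W.baseChange K).HasGoodReductionAt v ∨ ¬ (W'.baseChange K).HasGoodReductionAt v)} →
      ∀ (v₀ : HeightOneSpectrum (𝓞 K)), ((3 : ℕ) : 𝓞 K) ∉ v₀.asIdeal →
      v₀ ∉ S → ∀ (F : absoluteGaloisGroup K → subgroupH1 (kerD κ 𝔭') ((W'.baseChange K).geomPrimaryTorsion 3)),
      (∀ (σ h : absoluteGaloisGroup K), h ∈ κ.kerSubgroup → F (σ * h) = F σ) →
      (∀ (d : decomp (K := K) 𝔭') (σ : absoluteGaloisGroup K), F ((d : absoluteGaloisGroup K) * σ) =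
        conjH1 (kerD κ 𝔭') ((W'.baseChange K).geomPrimaryTorsion 3) d (F σ)) →
      ∃ s ∈ selmerAc (W'.baseChange K) 3 κ v₀ S, ∀ σ : absoluteGaloisGroup K,
        resKerD κ ((W'.baseChange K).geomPrimaryTorsion 3) 𝔭' ((W'.baseChange K).conjH1 3 κ.kerSubgroup σ s) = F σ)
    (hsigS' : ∀ (S : Set (HeightOneSpectrum (𝓞 K))), S ⊆ {v : HeightOneSpectrum (𝓞 K) | ((3 : ℕ) : 𝓞 K) ∉ v.asIdeal ∧
        (¬ (W.baseChange K).HasGoodReductionAt v ∨ ¬ (W'.baseChange K).HasGoodReductionAt v)} →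
      ∀ (v : HeightOneSpectrum (𝓞 K)), ((3 : ℕ) : 𝓞 K) ∉ v.asIdeal →
      (¬ (W.baseChange K).HasGoodReductionAt v ∨ ¬ (W'.baseChange K).HasGoodReductionAt v) →
      v ∉ S → ¬ (decomp v ≤ κ.kerSubgroup) →
      ∀ (F : absoluteGaloisGroup K → subgroupH1 (kerD κ v) ((W'.baseChange K).geomPrimaryTorsion 3)),
      (∀ (σ h : absoluteGaloisGroup K), h ∈ κ.kerSubgroup → F (σ * h) = F σ) →
      (∀ (d : decomp (K := K) v) (σ : absoluteGaloisGroup K), F ((d : absoluteGaloisGroup K) * σ) =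
        conjH1 (kerD κ v) ((W'.baseChange K).geomPrimaryTorsion 3) d (F σ)) →
      ∃ s ∈ selmerAc (W'.baseChange K) 3 κ 𝔭' (insert v S), ∀ σ : absoluteGaloisGroup K,
        resKerD κ ((W'.baseChange K).geomPrimaryTorsion 3) v ((W'.baseChange K).conjH1 3 κ.kerSubgroup σ s) = F σ) :
    ∃ (T : Finset (HeightOneSpectrum (𝓞 K))) (c s s' : HeightOneSpectrum (𝓞 K) → ℕ),
      (↑T = {v : HeightOneSpectrum (𝓞 K) | ((3 : ℕ) : 𝓞 K) ∉ v.asIdeal ∧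
        (¬ (W.baseChange K).HasGoodReductionAt v ∨ ¬ (W'.baseChange K).HasGoodReductionAt v)}) ∧
      (∀ v ∈ T, (∃ d₀ : decomp (K := K) v, (κ (d₀ : absoluteGaloisGroup K)).toAdd = (3 : ℤ_[3]) ^ c v) ∧
        (∀ d : decomp (K := K) v, (3 : ℤ_[3]) ^ c v ∣ (κ (d : absoluteGaloisGroup K)).toAdd) ∧
        Nat.card {f : subgroupH1 (kerD κ v) ((W.baseChange K).geomPrimaryTorsion 3) // 3 • f = 0} =
          3 ^ s v ∧
        Nat.card {f : subgroupH1 (kerD κ v) ((W'.baseChange K).geomPrimaryTorsion 3) // 3 • f = 0} =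
          3 ^ s' v) ∧
      (∃ g : UnrSeries 3,
        (XAc.charIdeal (W.baseChange K) 3 κ 𝔭' ∅ γ).map (PowerSeries.map (Halves.toUnr 3)) =
            Ideal.span {g} ∧
          (∀ i < lambdaInvariant 3 (XAc (W.baseChange K) 3 κ 𝔭' ∅ γ),
            ‖((PowerSeries.coeff i g : unrIntegers 3) : ℂ_[3])‖ < 1) ∧
          ‖((PowerSeries.coeff (lambdaInvariant 3 (XAc (W.baseChange K) 3 κ 𝔭' ∅ γ)) g :
            unrIntegers 3) : ℂ_[3])‖ = 1) ∧
      Module.IsTorsion (IwasawaAlgebra 3) (XAc (W'.baseChange K) 3 κ 𝔭' ∅ γ) ∧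
      (∃ g' : UnrSeries 3,
        (XAc.charIdeal (W'.baseChange K) 3 κ 𝔭' ∅ γ).map (PowerSeries.map (Halves.toUnr 3)) =
            Ideal.span {g'} ∧
          (∀ i < lambdaInvariant 3 (XAc (W'.baseChange K) 3 κ 𝔭' ∅ γ),
            ‖((PowerSeries.coeff i g' : unrIntegers 3) : ℂ_[3])‖ < 1) ∧
          ‖((PowerSeries.coeff (lambdaInvariant 3 (XAc (W'.baseChange K) 3 κ 𝔭' ∅ γ)) g' :
            unrIntegers 3) : ℂ_[3])‖ = 1) ∧
      lambdaInvariant 3 (XAc (W'.baseChange K) 3 κ 𝔭' ∅ γ) + ∑ v ∈ T, 3 ^ c v * s' v ≤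
        lambdaInvariant 3 (XAc (W.baseChange K) 3 κ 𝔭' ∅ γ) + ∑ v ∈ T, 3 ^ c v * s v := by
  haveI : Fact (Nat.Prime 3) := ⟨Nat.prime_three⟩
  haveI : IsTotallyComplex K := hK.2
  haveI hEK : (W.baseChange K).IsElliptic := by rw [WeierstrassCurve.baseChange]; infer_instance
  haveI hEK' : (W'.baseChange K).IsElliptic := by rw [WeierstrassCurve.baseChange]; infer_instance
  -- the bad set `Σ`
  set S : Set (HeightOneSpectrum (𝓞 K)) := {v | ((3 : ℕ) : 𝓞 K) ∉ v.asIdeal ∧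
    (¬ (W.baseChange K).HasGoodReductionAt v ∨ ¬ (W'.baseChange K).HasGoodReductionAt v)} with hSdef
  have hSfin : S.Finite := by
    refine (((W.baseChange K).finite_badPlaces_holds (𝓞 K)).union
      ((W'.baseChange K).finite_badPlaces_holds (𝓞 K))).subset fun v hv ↦ ?_
    rcases hv.2 with h | h
    · exact Or.inl h
    · exact Or.inr h
  have hSp : ∀ v ∈ S, ((3 : ℕ) : 𝓞 K) ∉ v.asIdeal := fun v hv ↦ hv.1
  have hSdec : ∀ v ∈ S, ¬ (decomp v ≤ κ.kerSubgroup) := by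
    intro v hv
    rcases hv.2 with h | h
    · exact not_decomp_le_kerSubgroup_of_not_hasGoodReductionAt_baseChange W hN K hK hHe (by decide) κ
        hκ hv.1 h
    · exact not_decomp_le_kerSubgroup_of_not_hasGoodReductionAt_baseChange W' hN' K hK hHe' (by decide)
        κ hκ hv.1 h
  have hgood : ∀ v : HeightOneSpectrum (𝓞 K), v ∉ S → ((3 : ℕ) : 𝓞 K) ∉ v.asIdeal →
      (W.baseChange K).HasGoodReductionAt v := fun v hv hpv ↦ by
    by_contra h; exact hv ⟨hpv, Or.inl h⟩
  have hgood' : ∀ v : HeightOneSpectrum (𝓞 K), v ∉ S → ((3 : ℕ) : 𝓞 K) ∉ v.asIdeal →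
      (W'.baseChange K).HasGoodReductionAt v := fun v hv hpv ↦ by
    by_contra h; exact hv ⟨hpv, Or.inr h⟩
  choose! c hc₀ hc hdvd using fun v (hv : v ∈ S) ↦ exists_pow_and_forall_dvd_of_not_le κ v (hSdec v hv)
  -- `3` splits in the Heegner field
  have hadd : Addv W 3 := hO6.2.1
  have hpN : 3 ∣ W.conductorNorm ℤ := (W.dvd_conductorNorm_iff_not_hasGoodReductionAtPrime 3).mpr hadd.1
  have hsplit : SplitsIn K 3 := hHe 3 (Fact.out) (hN ▸ hpN)
  -- the wild curve: `μ = 0` from the wall, generator with profile `λ`, (N1) at `∅`, `Sel^Σ[3]` finite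
  haveI := XAc.module_finite κ 𝔭' (∅ : Set (HeightOneSpectrum (𝓞 K))) γ Set.finite_empty (W := W.baseChange K)
  have hμe : muInvariant 3 (XAc (W.baseChange K) 3 κ 𝔭' ∅ γ) = 0 :=
    muInvariant_eq_zero_of_span_le_map_charIdeal (XAc (W.baseChange K) 3 κ 𝔭' ∅ γ) hT hle hi
  obtain ⟨g, hg, hglt, hgeq⟩ :=
    exists_generator_normProfile_lambdaInvariant (W.baseChange K) 3 κ 𝔭' ∅ γ Set.finite_empty hT hμe
  have hnf := (forall_finite_eq_bot_sigma_anyTorsion W 3 hPT hPT2 hK hsplit κ γ h𝔭' hfin ∅).1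
  have hfine : Set.Finite {s : selmerAc (W.baseChange K) 3 κ 𝔭' ∅ | 3 • s = 0} :=
    finite_pTorsion_of_muInvariant_eq_zero (W.baseChange K) 3 κ 𝔭' ∅ γ hT hμe
  have hfinS : Set.Finite {s : selmerAc (W.baseChange K) 3 κ 𝔭' S | 3 • s = 0} :=
    finite_selmerAc_pTorsion_of_empty (W.baseChange K) κ hSfin hSp hSdec hfine
  -- local tower torsion finiteness at `𝔭′` (E: Serre Prop. 8 on the O6 class; twin: by reduction type)
  have hδ : LocalTowerTorsionFiniteAt (W.baseChange K) 3 κ 𝔭' :=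
    localTowerTorsionFiniteClaim_three_of_classO6 Serre1967.noStableDivisibleLine_of_potentiallySupersingular_holds W
      hO6 K hK hsplit κ hκ 𝔭' h𝔭'
  have hδ' : LocalTowerTorsionFiniteAt (W'.baseChange K) 3 κ 𝔭' :=
    localTowerTorsionFiniteAt_baseChange_three_of_not_addv W' hadd' hK hsplit κ hκ 𝔭' h𝔭'
  -- (S′) in tuple form at `𝔭′`
  have hsurj' : ∀ (v₀ : HeightOneSpectrum (𝓞 K)), ((3 : ℕ) : 𝓞 K) ∉ v₀.asIdeal → v₀ ∉ S → ∀ (c : ℕ),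
      (∀ z : ℤ_[3], ∃ d : decomp (K := K) 𝔭', (κ (d : absoluteGaloisGroup K)).toAdd = (3 : ℤ_[3]) ^ c * z) →
      (∀ d : decomp (K := K) 𝔭', (3 : ℤ_[3]) ^ c ∣ (κ (d : absoluteGaloisGroup K)).toAdd) →
      ∀ g : Fin (3 ^ c) → subgroupH1 (kerD κ 𝔭') ((W'.baseChange K).geomPrimaryTorsion 3),
        ∃ s ∈ selmerAc (W'.baseChange K) 3 κ v₀ S, ∀ i : Fin (3 ^ c),
          resKerD κ ((W'.baseChange K).geomPrimaryTorsion 3) 𝔭'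
            ((W'.baseChange K).conjH1 3 κ.kerSubgroup (γ ^ (i : ℕ)) s) = g i := by
    intro v₀ hv₀ hv₀S c hc hle g
    exact exists_mem_forall_fin_of_forall_sig (W'.baseChange K) 3 κ (Fact.out : κ.IsTopGenerator γ) 𝔭' hc hle
      (selmerAc (W'.baseChange K) 3 κ v₀ S) (hsig' S rfl v₀ hv₀ hv₀S) g
  -- (M1) WITH INDEX: `Sel^Σ(E′)[3]` finite and `#Sel^Σ(E′)[3] ≤ #Sel^Σ(E)[3] · #(Sel^Σ(E′)/3)`
  obtain ⟨hfinS', hM1⟩ := finite_and_natCard_selmerAc_pTorsion_baseChange_le_of_modPCongruent_of_surj W W' 3 (by decide)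
    hK hsplit hPT hPT2 κ hκ (γ := γ) Fact.out h𝔭' (by exact_mod_cast hsurj) hcong hSfin hgood hgood' hfin hsurj' hfinS hδ hδ'
  -- the twin at `Σ`: torsion, `μ = 0`; Herbrand `3^{λ(X′^Σ)} · #X′^Σ[3] = #Sel^Σ(E′)[3]`; Pontryagin `#X′^Σ[3] = #(Sel′/3)`
  haveI := XAc.module_finite κ 𝔭' S γ hSfin (W := W'.baseChange K)
  have hT'S : Module.IsTorsion (IwasawaAlgebra 3) (XAc (W'.baseChange K) 3 κ 𝔭' S γ) :=
    isTorsion_of_finite_pTorsion (W'.baseChange K) 3 κ 𝔭' S γ hSfin hfinS'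
  have hμ'S : muInvariant 3 (XAc (W'.baseChange K) 3 κ 𝔭' S γ) = 0 :=
    muInvariant_eq_zero_of_finite_pTorsion (W'.baseChange K) 3 κ 𝔭' S γ hSfin hfinS'
  have hHerb := ResidualDevissageCountNonsplit.pow_lambdaInvariant_mul_natCard_pTorsion_eq (W'.baseChange K) 3 κ 𝔭' S γ
    hSfin hfinS'
  have hPont := natCard_pTorsion_XAc_eq_natCard_quotient (W'.baseChange K) 3 κ 𝔭' S γ
  -- finiteness and positivity of the counts
  have hSel'pos : Nat.card {s : selmerAc (W'.baseChange K) 3 κ 𝔭' S // 3 • s = 0} ≠ 0 := by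
    haveI : Finite {s : selmerAc (W'.baseChange K) 3 κ 𝔭' S // 3 • s = 0} := hfinS'.to_subtype
    haveI : Nonempty {s : selmerAc (W'.baseChange K) 3 κ 𝔭' S // 3 • s = 0} := ⟨⟨0, smul_zero 3⟩⟩
    exact Nat.card_pos.ne'
  have hX'pos : Nat.card {x : XAc (W'.baseChange K) 3 κ 𝔭' S γ // 3 • x = 0} ≠ 0 := by
    intro h0; rw [h0, mul_zero] at hHerb; exact hSel'pos hHerb.symm
  have hQfin : Finite (↥(selmerAc (W'.baseChange K) 3 κ 𝔭' S) ⧸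
      (nsmulAddMonoidHom (α := ↥(selmerAc (W'.baseChange K) 3 κ 𝔭' S)) 3).range) :=
    Nat.finite_of_card_ne_zero (hPont ▸ hX'pos)
  have hM1' := hM1 hQfin
  -- the wild curve's count `#Sel^Σ(E)[3] = 3^λ · ∏ (#P_v[3])^{3^{c_v}}`
  have hprod := natCard_quotient_pTorsion_baseChange_eq_prod_anyTorsion W 3 hPT hPT2 hK hsplit κ γ h𝔭'
    hfin hSfin hSp c hc hdvd hfinS
  have hE := pow_lambdaInvariant_mul_natCard_eq (W.baseChange K) 3 κ 𝔭' S γ hT hμe hnf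
  -- the places of `Σ` and the local exponents
  have hTp : ∀ v ∈ hSfin.toFinset, ((3 : ℕ) : 𝓞 K) ∉ v.asIdeal := fun v hv ↦ hSp v (hSfin.mem_toFinset.mp hv)
  have hTdec : ∀ v ∈ hSfin.toFinset, ¬ (decomp v ≤ κ.kerSubgroup) := fun v hv ↦
    hSdec v (hSfin.mem_toFinset.mp hv)
  choose! s hs using fun v (hv : v ∈ hSfin.toFinset) ↦
    exists_natCard_pTorsion_subgroupH1_kerD_eq_pow (W.baseChange K) κ (by exact_mod_cast hTp v hv)
      (hTdec v hv)
  choose! s' hs' using fun v (hv : v ∈ hSfin.toFinset) ↦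
    exists_natCard_pTorsion_subgroupH1_kerD_eq_pow (W'.baseChange K) κ (by exact_mod_cast hTp v hv)
      (hTdec v hv)
  have e1 : ∏ v ∈ hSfin.toFinset, Nat.card {f : subgroupH1 (kerD κ v) ((W.baseChange K).geomPrimaryTorsion 3) //
      3 • f = 0} ^ (3 ^ c v) = 3 ^ ∑ v ∈ hSfin.toFinset, 3 ^ c v * s v := by
    rw [← Finset.prod_pow_eq_pow_sum]
    exact Finset.prod_congr rfl fun v hv ↦ by rw [hs v hv, ← pow_mul, Nat.mul_comm (s v)]
  -- (1) `λ(X′^Σ) ≤ λ + Σ`: `3^{λ(X′^Σ)}·#X′^Σ[3] = #Sel′[3] ≤ #Sel[3]·#X′^Σ[3]`, `#Sel[3] = 3^{λ+Σ}`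
  have hup : lambdaInvariant 3 (XAc (W'.baseChange K) 3 κ 𝔭' S γ) ≤
      lambdaInvariant 3 (XAc (W.baseChange K) 3 κ 𝔭' ∅ γ) + ∑ v ∈ hSfin.toFinset, 3 ^ c v * s v := by
    have h1 : 3 ^ lambdaInvariant 3 (XAc (W'.baseChange K) 3 κ 𝔭' S γ) *
        Nat.card {x : XAc (W'.baseChange K) 3 κ 𝔭' S γ // 3 • x = 0} ≤
        Nat.card {s : selmerAc (W.baseChange K) 3 κ 𝔭' S // 3 • s = 0} *
          Nat.card {x : XAc (W'.baseChange K) 3 κ 𝔭' S γ // 3 • x = 0} := by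
      rw [hHerb, hPont]; exact hM1'
    have h2 : 3 ^ lambdaInvariant 3 (XAc (W'.baseChange K) 3 κ 𝔭' S γ) ≤
        Nat.card {s : selmerAc (W.baseChange K) 3 κ 𝔭' S // 3 • s = 0} :=
      Nat.le_of_mul_le_mul_right h1 (Nat.pos_of_ne_zero hX'pos)
    rw [← hE, hprod, e1, ← pow_add] at h2
    exact (Nat.pow_le_pow_iff_right (by norm_num : 2 ≤ 3)).mp h2
  -- (2) `λ(X′^Σ) = λ′ + corank(Sel^Σ(E′)/Sel^∅(E′))` (Eisenstein cell, on the definitionally equal Literature twins)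
  haveI : Module.Finite (IwasawaAlgebra 3) (Castella2018.AcSelmer.XAc (W'.baseChange K) 3 κ 𝔭' S γ) :=
    XAc.module_finite κ 𝔭' S γ hSfin (W := W'.baseChange K)
  obtain ⟨hfg', hT', hμ', -, hshift⟩ := XAcImprimitiveLambdaShift.lambdaInvariant_eq_add_zpCorank_of_muInvariant_eq_zero
    (W'.baseChange K) 3 κ 𝔭' (γ := γ) (Set.empty_subset S) hT'S hμ'S
  change Module.Finite (IwasawaAlgebra 3) (XAc (W'.baseChange K) 3 κ 𝔭' ∅ γ) at hfg'
  change Module.IsTorsion (IwasawaAlgebra 3) (XAc (W'.baseChange K) 3 κ 𝔭' ∅ γ) at hT'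
  change muInvariant 3 (XAc (W'.baseChange K) 3 κ 𝔭' ∅ γ) = 0 at hμ'
  change lambdaInvariant 3 (XAc (W'.baseChange K) 3 κ 𝔭' S γ) = lambdaInvariant 3 (XAc (W'.baseChange K) 3 κ 𝔭' ∅ γ) +
    zpCorank (↥(selmerAc (W'.baseChange K) 3 κ 𝔭' S) ⧸
      (selmerAc (W'.baseChange K) 3 κ 𝔭' ∅).addSubgroupOf (selmerAc (W'.baseChange K) 3 κ 𝔭' S)) 3 at hshift
  -- (3) the corank from (Σ′): `= Σ 3^{c_v} s′_v`
  have hST : S = ∅ ∪ ↑hSfin.toFinset := by rw [Set.empty_union, Set.Finite.coe_toFinset]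
  obtain ⟨-, hcork⟩ := finite_and_zpCorank_quotient_eq_sum_of_surj (W'.baseChange K) 3 κ (𝔭 := 𝔭')
    (Fact.out : κ.IsTopGenerator γ) ∅ c s' hSfin.toFinset hTp (fun v _ ↦ Set.notMem_empty v) hTdec
    (fun v hv ↦ hc v ((Set.Finite.mem_toFinset hSfin).mp hv)) hs'
    (fun v hv S' _ hS'T hvS' f ↦ by
      have hv' := (Set.Finite.mem_toFinset hSfin).mp hv
      have hS'S : S' ⊆ S := fun w hw ↦ by
        rcases hS'T hw with h | h
        · exact absurd h (Set.notMem_empty w)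
        · exact (Set.Finite.mem_toFinset hSfin).mp h
      exact exists_mem_forall_fin_of_forall_sig (W'.baseChange K) 3 κ (Fact.out : κ.IsTopGenerator γ) v (hc v hv')
        (hdvd v hv') (selmerAc (W'.baseChange K) 3 κ 𝔭' (insert v S'))
        (hsigS' S' hS'S v (hSp v hv') hv'.2 hvS' (hSdec v hv')) f)
  rw [← hST] at hcork
  -- the twin's generator with profile `λ′`
  obtain ⟨g', hg', hglt', hgeq'⟩ :=
    exists_generator_normProfile_lambdaInvariant (W'.baseChange K) 3 κ 𝔭' ∅ γ Set.finite_empty hT' hμ'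
  refine ⟨hSfin.toFinset, c, s, s', hSfin.coe_toFinset, fun v hv ↦ ⟨hc₀ v (hSfin.mem_toFinset.mp hv),
    hdvd v (hSfin.mem_toFinset.mp hv), hs v hv, hs' v hv⟩, ⟨g, hg, hglt, hgeq⟩, hT', ⟨g', hg', hglt', hgeq'⟩, ?_⟩
  rw [← hcork, ← hshift]
  exact hup

end Summit.BirchSwinnertonDyer.BirchSwinnertonDyer.Cruxes.DefectTransportModThreePT.SigmaCongruence

end
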